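import Literature.Computability.QuantumComplexity.ForrelationDerivativeTables
import Literature.Computability.QuantumComplexity.CubicForrelationEstimatorAnalysis
import Literature.InformationTheory.Coding.QuadraticBooleanWalshProofs

/-!
# Crux `CubicForrelation.NearExactIsExact` (stmt-QuantumAdvantage-14043), stub `stub_quadWalshPlateau`

Line `direct-sum-amplification`, stub QW (`stub_quadWalshPlateau`, KNOWN — Dickson's theorem in
support form, MacWilliams–Sloane Ch. 15 §2 Thm 5 / Carlet 2020 Prop. 55): the Walsh spectrum
`W(v) = ∑_x (-1)^{q(x)} (-1)^{x·v}` of a Boolean function `q` of algebraic degree `≤ 2` is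
PLATEAUED at an EVEN level: there is one `s` (uniform in `v`) with `W(v) ∈ {0, ±2^s}` for every
`v`, i.e. `W(v) = 0 ∨ W(v)² = 4^s`.

Proof (everything from the tree, no named facts):
* bridge `IsDegLeFun 2 q` (a representing polynomial of total degree `≤ 2`) to
  `QuadPolar.toZFun q ∈ CHHL2018.lowDeg n 2` (`QuadPolar.toZFun_mem_lowDeg_of_poly`);
* `W (signOf ∘ q) v = QuadSampler.walsh q v` (`CubicDequant.sgnZ_toZFun`, `twist_comm`);
* Dickson, support form (`QuadSampler.walsh_sq_eq`): `(walsh q v)² = 2ⁿ · (|rad q| or 0)`, and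
  `|rad q| = 2^d` (`CubicDequant.card_rad_eq_two_pow`), so off the support `W(v) = 0` and on it
  `W(v)² = 2^{n+d}`, with `d` independent of `v`;
* `W(v)` is an integer (a sum of products of two signs), so `2^{n+d}` being an integer square
  forces `|W(v)| = 2^{(n+d)/2}` (`Carlet2020Prop55.abs_eq_two_pow_half_of_sq_eq`), whence
  `W(v)² = 4^{(n+d)/2}`; take `s := (n + d) / 2`.

Sources: F. J. MacWilliams, N. J. A. Sloane, *The Theory of Error-Correcting Codes* (1977), Ch. 15
§2 Thm 5; C. Carlet, *Boolean Functions for Cryptography and Coding Theory* (2020), §5.2 Prop. 55.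
-/

set_option linter.dupNamespace false -- D-0017: single-problem summit ⇒ `QuantumAdvantage.QuantumAdvantage` by design

namespace Summit.QuantumAdvantage.QuantumAdvantage.Theorems.CubicForrelation.NearExactIsExact

open Finset
open Literature.Computability.QuantumComplexity
open Literature.Computability.QuantumComplexity.DerivativeWalsh (W)

variable {n : ℕ}

/-- The derivative-table Walsh transform of the sign reading of `q` is the sampler's `walsh q`:
`∑_x (-1)^{q x} (-1)^{x·v} = ∑_x sgnZ [q x] (-1)^{v·x}`. -/
theorem qw_W_signOf_eq_walsh (q : (Fin n → Bool) → Bool) (v : Fin n → Bool) :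
    W (fun x => signOf (q x)) v = QuadSampler.walsh q v := by
  unfold W QuadSampler.walsh
  refine sum_congr rfl fun x _ => ?_
  rw [CubicDequant.sgnZ_toZFun, twist_comm]

/-- The Walsh transform of a sign function is an integer (a sum of products of two signs). -/
theorem qw_W_signOf_int (q : (Fin n → Bool) → Bool) (v : Fin n → Bool) :
    ∃ z : ℤ, W (fun x => signOf (q x)) v = z := by
  refine ⟨∑ x, (if q x then (-1 : ℤ) else 1) * (if twist x v = 1 then (1 : ℤ) else -1), ?_⟩
  unfold W
  push_cast
  refine sum_congr rfl fun x _ => ?_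
  rcases Simon.twist_eq_one_or x v with h | h <;> cases q x <;> norm_num [signOf, h]

/-- **stub_quadWalshPlateau** (QW; KNOWN — Dickson's theorem in support form, MacWilliams–Sloane
Ch. 15 §2 Thm 5 / Carlet 2020 Prop. 55). The Walsh spectrum of a function of degree `≤ 2` is
PLATEAUED at an EVEN level: there is `s` with `W(v) ∈ {0, ±2^s}` for all `v`. Route: bridge
`IsDegLeFun 2 q` to `toZFun q ∈ lowDeg n 2`, then `QuadSampler.walsh_sq_eq`
(`W² = 2ⁿ·|rad|·[support]`), `card_rad_eq_two_pow` (`|rad| = 2^d`), and integrality of `W`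
(`abs_eq_two_pow_half_of_sq_eq`: an integer square equal to `2^N` is `4^{N/2}`). -/
theorem stub_quadWalshPlateau :
    ∀ (n : ℕ) (q : (Fin n → Bool) → Bool), IsDegLeFun 2 q →
      ∃ s : ℕ, ∀ v, W (fun x => signOf (q x)) v = 0 ∨ W (fun x => signOf (q x)) v ^ 2 = (4 : ℝ) ^ s := by
  intro n q hq
  obtain ⟨p, hp, hpq⟩ := hq
  have hlow : QuadPolar.toZFun q ∈ CHHL2018.lowDeg n 2 :=
    QuadPolar.toZFun_mem_lowDeg_of_poly p hp fun x => by rw [hpq x, polyPhase_apply]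
  obtain ⟨d, -, hd⟩ := CubicDequant.card_rad_eq_two_pow hlow
  refine ⟨(n + d) / 2, fun v => ?_⟩
  have hsq := QuadSampler.walsh_sq_eq hlow v
  rw [← qw_W_signOf_eq_walsh] at hsq
  split_ifs at hsq
  · right
    obtain ⟨z, hz⟩ := qw_W_signOf_int q v
    have h1 : (z : ℝ) ^ 2 = ((2 : ℤ) ^ (n + d) : ℤ) := by
      rw [← hz, hsq, hd, pow_add]
      push_cast
      ring
    have hz2 : z ^ 2 = 2 ^ (n + d) := by exact_mod_cast h1
    have habs :=
      Literature.InformationTheory.Coding.Carlet2020Prop55.abs_eq_two_pow_half_of_sq_eq hz2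
    have h4 : z ^ 2 = 4 ^ ((n + d) / 2) := by
      rw [← sq_abs, habs, ← pow_mul, pow_mul']
      norm_num
    rw [hz]
    exact_mod_cast h4
  · left
    rw [mul_zero] at hsq
    exact (pow_eq_zero_iff two_ne_zero).mp hsq

end Summit.QuantumAdvantage.QuantumAdvantage.Theorems.CubicForrelation.NearExactIsExact
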